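import Mathlib
import HarnessLib
import Summits.RiemannHypothesis.RiemannHypothesis.Theorems.IntegerScrewContinuumDefs

/-!
# Route `IntegerScrew` — the continuum screw Gram matrices are positive semidefinite, with no hypothesis

`IntegerScrewContinuumDefs` defines the continuum screw function
`Ψ₀(t) = ∫_{γ > 2π} 2(1 − cos γt)/γ² · ρ(γ) dγ`, `ρ(γ) = log(γ/2π)/(2π)`, and the Gram matrices
`continuumScrewMatrix n = [Ψ₀(tᵢ) + Ψ₀(tⱼ) − Ψ₀(tᵢ − tⱼ)]`, `tᵢ = log(i+2)`. Here we prove what the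
docstring there announces: every `continuumScrewMatrix n` is positive semidefinite. The proof is the
«sum of rank-two atoms» identity

`xᵀ K₀ x = ∫_{γ > 2π} (2ρ(γ)/γ²) · [(∑ᵢ xᵢ (cos(γ tᵢ) − 1))² + (∑ᵢ xᵢ sin(γ tᵢ))²] dγ ≥ 0`,

which only needs (i) absolute integrability of the integrand of `Ψ₀` on `(2π, ∞)` (it is bounded by
`4 γ^{−3/2}` there, since `0 ≤ log(γ/2π)/(2π) ≤ √γ`), (ii) the trigonometric identity
`(1 − cos a) + (1 − cos b) − (1 − cos(a − b)) = (cos a − 1)(cos b − 1) + sin a · sin b`, and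
(iii) `ρ ≥ 0` on `(2π, ∞)`. This is the continuum counterpart of the RH-conditional statement
«`S_M` is a sum of one rank-two atom per zero» (Suzuki2023 (1.9)); for the continuum kernel it is
unconditional because the smooth density replaces the zeros. Nothing here bears on `ζ`.
[cite: Suzuki2023, (1.9)]
-/

noncomputable section

-- D-0017: `Summit.<S>.<S>.…` is the designed namespace of a single-problem summit.
set_option linter.dupNamespace false

namespace Summit.RiemannHypothesis.RiemannHypothesis.Theorems.IntegerScrew

open Real MeasureTheory Set Matrix

/-- The integrand of `Ψ₀`: `f(γ, t) = 2(1 − cos(γ t))/γ² · ρ(γ)` (`continuumScrew t = ∫_{γ>2π} f(γ,t) dγ`).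
[folklore] -/
def continuumScrewIntegrand (t γ : ℝ) : ℝ :=
  2 * (1 - Real.cos (γ * t)) / γ ^ 2 * continuumScrewDensity γ

/-- `Ψ₀(t)` is the integral of `continuumScrewIntegrand t` over `(2π, ∞)` (definitional). -/
theorem continuumScrew_eq_integral (t : ℝ) :
    continuumScrew t = ∫ γ in Ioi (2 * π), continuumScrewIntegrand t γ := rfl

/-- `ρ(γ) ≥ 0` for `γ > 2π`. -/
theorem continuumScrewDensity_nonneg {γ : ℝ} (hγ : 2 * π < γ) : 0 ≤ continuumScrewDensity γ := by
  unfold continuumScrewDensity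
  have h2π : 0 < 2 * π := by positivity
  have h1 : 1 ≤ γ / (2 * π) := by
    rw [le_div_iff₀ h2π]; linarith
  exact div_nonneg (Real.log_nonneg h1) h2π.le

/-- `ρ(γ) ≤ √γ` for `γ > 2π` (crude: `log y ≤ 2√y` and `2π ≥ 2`). -/
theorem continuumScrewDensity_le_sqrt {γ : ℝ} (hγ : 2 * π < γ) : continuumScrewDensity γ ≤ √γ := by
  unfold continuumScrewDensity
  have hπ3 : 3 < π := Real.pi_gt_three
  have h2π : 0 < 2 * π := by positivity
  have hγ0 : 0 < γ := lt_trans h2π hγ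
  -- log(γ/(2π)) ≤ log γ ≤ 2 √γ
  have hlog1 : Real.log (γ / (2 * π)) ≤ Real.log γ := by
    apply Real.log_le_log (div_pos hγ0 h2π)
    rw [div_le_iff₀ h2π]; nlinarith
  have hsqrt_pos : 0 < √γ := Real.sqrt_pos.mpr hγ0
  have hlog2 : Real.log γ ≤ 2 * √γ := by
    have h := Real.log_le_sub_one_of_pos hsqrt_pos
    have hs : Real.log (√γ) = Real.log γ / 2 := Real.log_sqrt hγ0.le
    rw [hs] at h
    linarith
  have hnum : Real.log (γ / (2 * π)) ≤ 2 * √γ := hlog1.trans hlog2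
  calc Real.log (γ / (2 * π)) / (2 * π) ≤ 2 * √γ / (2 * π) :=
        div_le_div_of_nonneg_right hnum h2π.le
    _ ≤ 2 * √γ / 2 := by
        apply div_le_div_of_nonneg_left (by positivity) (by norm_num) (by linarith)
    _ = √γ := by ring

/-- Pointwise bound `0 ≤ f(γ,t) ≤ 4 γ^{−3/2}` on `(2π, ∞)`. -/
theorem continuumScrewIntegrand_nonneg (t : ℝ) {γ : ℝ} (hγ : 2 * π < γ) :
    0 ≤ continuumScrewIntegrand t γ := by
  unfold continuumScrewIntegrand
  have hc : 0 ≤ 1 - Real.cos (γ * t) := by linarith [Real.cos_le_one (γ * t)]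
  have hρ := continuumScrewDensity_nonneg hγ
  positivity

/-- The majorant: `f(γ,t) ≤ 4 γ^{−3/2}` for `γ > 2π` (from `1 − cos ≤ 2` and `ρ ≤ √γ`). -/
theorem continuumScrewIntegrand_le (t : ℝ) {γ : ℝ} (hγ : 2 * π < γ) :
    continuumScrewIntegrand t γ ≤ 4 * γ ^ (-(3 : ℝ) / 2) := by
  unfold continuumScrewIntegrand
  have h2π : 0 < 2 * π := by positivity
  have hγ0 : 0 < γ := lt_trans h2π hγ
  have hc : 1 - Real.cos (γ * t) ≤ 2 := by linarith [Real.neg_one_le_cos (γ * t)]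
  have hc0 : 0 ≤ 1 - Real.cos (γ * t) := by linarith [Real.cos_le_one (γ * t)]
  have hρ := continuumScrewDensity_nonneg hγ
  have hρ' := continuumScrewDensity_le_sqrt hγ
  have hγ2 : 0 < γ ^ 2 := by positivity
  -- 2(1 - cos)/γ² · ρ ≤ (4/γ²) · √γ
  have step1 : 2 * (1 - Real.cos (γ * t)) / γ ^ 2 * continuumScrewDensity γ ≤ 4 / γ ^ 2 * √γ := by
    have ha : 2 * (1 - Real.cos (γ * t)) / γ ^ 2 ≤ 4 / γ ^ 2 := by
      apply div_le_div_of_nonneg_right _ hγ2.le; linarith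
    have ha0 : 0 ≤ 2 * (1 - Real.cos (γ * t)) / γ ^ 2 := by positivity
    calc 2 * (1 - Real.cos (γ * t)) / γ ^ 2 * continuumScrewDensity γ
        ≤ 2 * (1 - Real.cos (γ * t)) / γ ^ 2 * √γ := mul_le_mul_of_nonneg_left hρ' ha0
      _ ≤ 4 / γ ^ 2 * √γ := mul_le_mul_of_nonneg_right ha (Real.sqrt_nonneg γ)
  -- 4/γ² · √γ = 4 γ^{-3/2}
  have step2 : 4 / γ ^ 2 * √γ = 4 * γ ^ (-(3 : ℝ) / 2) := by
    rw [Real.sqrt_eq_rpow, show (γ ^ 2 : ℝ) = γ ^ (2 : ℝ) by norm_cast, div_mul_eq_mul_div,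
      mul_div_assoc, ← Real.rpow_sub hγ0]
    norm_num
  linarith [step1, step2.le]

/-- The integrand of `Ψ₀` is integrable on `(2π, ∞)` for every real `t`. -/
theorem continuumScrewIntegrand_integrableOn (t : ℝ) :
    IntegrableOn (continuumScrewIntegrand t) (Ioi (2 * π)) := by
  have h2π : (0 : ℝ) < 2 * π := by positivity
  have hg : IntegrableOn (fun γ : ℝ => 4 * γ ^ (-(3 : ℝ) / 2)) (Ioi (2 * π)) :=
    (integrableOn_Ioi_rpow_of_lt (by norm_num) h2π).const_mul 4
  have hmeas : AEStronglyMeasurable (continuumScrewIntegrand t) (volume.restrict (Ioi (2 * π))) := by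
    have : Measurable (continuumScrewIntegrand t) := by
      unfold continuumScrewIntegrand continuumScrewDensity
      fun_prop
    exact this.aestronglyMeasurable
  refine Integrable.mono' hg hmeas ?_
  filter_upwards [ae_restrict_mem measurableSet_Ioi] with γ hγ
  rw [Real.norm_eq_abs, abs_of_nonneg (continuumScrewIntegrand_nonneg t hγ)]
  exact continuumScrewIntegrand_le t hγ

/-- The trigonometric identity behind the rank-two atoms:
`f(γ,a) + f(γ,b) − f(γ,a−b) = (2ρ/γ²)·[(cos γa − 1)(cos γb − 1) + sin γa · sin γb]`. -/
theorem continuumScrewIntegrand_kernel (a b γ : ℝ) :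
    continuumScrewIntegrand a γ + continuumScrewIntegrand b γ - continuumScrewIntegrand (a - b) γ =
      2 / γ ^ 2 * continuumScrewDensity γ *
        ((Real.cos (γ * a) - 1) * (Real.cos (γ * b) - 1) + Real.sin (γ * a) * Real.sin (γ * b)) := by
  unfold continuumScrewIntegrand
  have h : Real.cos (γ * (a - b)) = Real.cos (γ * a) * Real.cos (γ * b) + Real.sin (γ * a) * Real.sin (γ * b) := by
    rw [mul_sub, Real.cos_sub]
  rw [h]
  ring

/-- The continuum kernel as ONE integral of the rank-two atom. -/
theorem continuumScrewKernel_eq_integral (a b : ℝ) :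
    continuumScrewKernel a b =
      ∫ γ in Ioi (2 * π), 2 / γ ^ 2 * continuumScrewDensity γ *
        ((Real.cos (γ * a) - 1) * (Real.cos (γ * b) - 1) + Real.sin (γ * a) * Real.sin (γ * b)) := by
  unfold continuumScrewKernel
  have hA := continuumScrewIntegrand_integrableOn a
  have hB := continuumScrewIntegrand_integrableOn b
  have hC := continuumScrewIntegrand_integrableOn (a - b)
  have hAB : Integrable (fun γ => continuumScrewIntegrand a γ + continuumScrewIntegrand b γ)
      (volume.restrict (Ioi (2 * π))) := hA.add hB
  rw [continuumScrew_eq_integral, continuumScrew_eq_integral, continuumScrew_eq_integral,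
    ← integral_add hA hB, ← integral_sub hAB hC]
  refine integral_congr_ae (Filter.Eventually.of_forall fun γ => ?_)
  exact continuumScrewIntegrand_kernel a b γ

/-- The atom at height `γ` is integrable on `(2π, ∞)` (it is a combination of three integrands). -/
theorem continuumScrewAtom_integrableOn (a b : ℝ) :
    IntegrableOn (fun γ : ℝ => 2 / γ ^ 2 * continuumScrewDensity γ *
        ((Real.cos (γ * a) - 1) * (Real.cos (γ * b) - 1) + Real.sin (γ * a) * Real.sin (γ * b)))
      (Ioi (2 * π)) := by
  have h := ((continuumScrewIntegrand_integrableOn a).add (continuumScrewIntegrand_integrableOn b)).sub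
    (continuumScrewIntegrand_integrableOn (a - b))
  refine h.congr_fun (fun γ _ => ?_) measurableSet_Ioi
  exact continuumScrewIntegrand_kernel a b γ

/-- The quadratic form of `continuumScrewMatrix n` as an integral of squares:
`xᵀ K₀ x = ∫_{γ>2π} (2ρ/γ²)[(∑ xᵢ(cos γtᵢ − 1))² + (∑ xᵢ sin γtᵢ)²] dγ`. -/
theorem continuumScrewMatrix_form (n : ℕ) (x : Fin n → ℝ) :
    star x ⬝ᵥ (continuumScrewMatrix n *ᵥ x) =
      ∫ γ in Ioi (2 * π), 2 / γ ^ 2 * continuumScrewDensity γ *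
        ((∑ i : Fin n, x i * (Real.cos (γ * Real.log (((i : ℕ) + 2 : ℕ) : ℝ)) - 1)) ^ 2 +
         (∑ i : Fin n, x i * Real.sin (γ * Real.log (((i : ℕ) + 2 : ℕ) : ℝ))) ^ 2) := by
  -- abbreviations for the nodes
  set t : Fin n → ℝ := fun i => Real.log (((i : ℕ) + 2 : ℕ) : ℝ) with ht
  have hform : star x ⬝ᵥ (continuumScrewMatrix n *ᵥ x) =
      ∑ i : Fin n, ∑ j : Fin n, x i * x j * continuumScrewKernel (t i) (t j) := by
    simp only [star_trivial, dotProduct, Matrix.mulVec, continuumScrewMatrix, Matrix.of_apply,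
      Finset.mul_sum, ht]
    refine Finset.sum_congr rfl fun i _ => Finset.sum_congr rfl fun j _ => ?_
    ring
  rw [hform]
  -- the atom F i j γ = xᵢ xⱼ · (2ρ/γ²)[(cos γtᵢ − 1)(cos γtⱼ − 1) + sin γtᵢ sin γtⱼ]
  set F : Fin n → Fin n → ℝ → ℝ := fun i j γ => x i * x j * (2 / γ ^ 2 * continuumScrewDensity γ *
      ((Real.cos (γ * t i) - 1) * (Real.cos (γ * t j) - 1) + Real.sin (γ * t i) * Real.sin (γ * t j)))
    with hF
  have hI : ∀ i j : Fin n, IntegrableOn (F i j) (Ioi (2 * π)) := fun i j =>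
    (continuumScrewAtom_integrableOn (t i) (t j)).const_mul (x i * x j)
  have hentry : ∀ i j : Fin n, x i * x j * continuumScrewKernel (t i) (t j) =
      ∫ γ in Ioi (2 * π), F i j γ := by
    intro i j
    rw [continuumScrewKernel_eq_integral, ← integral_const_mul]
  have hinner : ∀ i : Fin n, ∑ j : Fin n, ∫ γ in Ioi (2 * π), F i j γ =
      ∫ γ in Ioi (2 * π), ∑ j : Fin n, F i j γ := fun i =>
    (integral_finsetSum Finset.univ (fun j _ => hI i j)).symm
  have hIi : ∀ i : Fin n, IntegrableOn (fun γ => ∑ j : Fin n, F i j γ) (Ioi (2 * π)) := fun i =>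
    integrable_finsetSum Finset.univ (fun j _ => hI i j)
  have houter : ∑ i : Fin n, ∫ γ in Ioi (2 * π), ∑ j : Fin n, F i j γ =
      ∫ γ in Ioi (2 * π), ∑ i : Fin n, ∑ j : Fin n, F i j γ :=
    (integral_finsetSum Finset.univ (fun i _ => hIi i)).symm
  calc ∑ i : Fin n, ∑ j : Fin n, x i * x j * continuumScrewKernel (t i) (t j)
      = ∑ i : Fin n, ∑ j : Fin n, ∫ γ in Ioi (2 * π), F i j γ := by
        refine Finset.sum_congr rfl fun i _ => Finset.sum_congr rfl fun j _ => hentry i j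
    _ = ∑ i : Fin n, ∫ γ in Ioi (2 * π), ∑ j : Fin n, F i j γ := by
        refine Finset.sum_congr rfl fun i _ => hinner i
    _ = ∫ γ in Ioi (2 * π), ∑ i : Fin n, ∑ j : Fin n, F i j γ := houter
    _ = _ := by
        refine setIntegral_congr_fun measurableSet_Ioi fun γ _ => ?_
        simp only [hF, ht, pow_two, Finset.mul_sum, ← Finset.sum_add_distrib]
        refine Finset.sum_congr rfl fun i _ => ?_
        simp only [Finset.sum_mul, Finset.mul_sum, ← Finset.sum_add_distrib]
        refine Finset.sum_congr rfl fun j _ => ?_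
        ring

/-- MAIN: every continuum screw Gram matrix is positive semidefinite — unconditionally (no `ζ`, no
RH): the continuum analogue of «`S_M` is a sum of one rank-two atom per zero». -/
theorem continuumScrewMatrix_posSemidef (n : ℕ) : (continuumScrewMatrix n).PosSemidef := by
  have hH : (continuumScrewMatrix n).IsHermitian :=
    Matrix.IsHermitian.ext fun i j => by
      rw [star_trivial]
      exact (continuumScrewMatrix_isSymm n).apply i j
  refine Matrix.PosSemidef.of_dotProduct_mulVec_nonneg hH fun x => ?_
  rw [continuumScrewMatrix_form]
  refine setIntegral_nonneg measurableSet_Ioi fun γ hγ => ?_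
  have hγ' : 2 * π < γ := hγ
  have hρ := continuumScrewDensity_nonneg hγ'
  positivity

end Summit.RiemannHypothesis.RiemannHypothesis.Theorems.IntegerScrew
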